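import Summits.BirchSwinnertonDyer.BirchSwinnertonDyer.Theorems.EisensteinPrimesB11DescentCertificate
import Summits.BirchSwinnertonDyer.BirchSwinnertonDyer.Theorems.EisensteinPrimesB11L3Cert19740v1
import HarnessLib

/-!
# Row B11 per pair, PREPRINT-FREE descent road — display `19740v1 @ 3`, a SECOND-LAYER (CTP) row of «OFFER-EIS-B11-D3 ADDENDUM-1»
# (RULING L82 (3) desk spot): `BSD(19740v1, 3)` from Gross–Zagier–Kolyvagin alone + the two READS, where the read `Ш[3] = 0` carries
# TWO method-disjoint certificates (A) first 3-isogeny descent + Cassels–Tate NONDEG (ctp3iso 0.2.2) and (B) full 3-descent (desc3borel)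
# (cell `bsd-eis`, seat `bsd-eis-k5-p4` g0; door `Theorems/EisensteinPrimesB11DescentCertificate.lean` p536512; THEOREMS ONLY — nothing booked)

HONEST FRAMING (cell `bsd-eis`, run/shared/lean/pub/bsd-eis/; row B11 = X2c = `CellC`; crux 4 `BSDpOnCellC` stmt-BirchSwinnertonDyer-19034
OPEN; no label or count moves; BSD proved for no curve unconditionally; `BSDp` only — no main-conjecture conjunct on this road). `19740v` is the
one WINDOW cell (N < 2·10⁴) of row B11 that the FIRST descent alone does not decide: class `19740v` = {v1, v2 (`#Ш_an = 1`), v3, v4 (`#Ш_an = 9`)}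
and every rational 3-isogeny kernel of the record `19740v1 = [0, 1, 0, -5045, 83100]` (`N = 19740 = 2²·3·5·7·47`, split at `3`) points at a
`#Ш_an = 9` member, so both engines read `(s_φ̂, s_φ, m, EXCESS) = (4, 0, 2, 2)` on the kernel `x − 85` (table `B11-DESC3R1-TABLE-v1.tsv`
3ba341440843231c, VERDICT `EXCESS`). READ `h : Ш(19740v1)[3] = 0` = referee A2's ROUND 795 standard, TWO certificates: **(A)** `s_φ = 0` ⇒
`Ш(E)[φ] = 0` (isogchi ‖ isogcft identical) and the Cassels–Tate pairing on `S^{(φ̂)}(E′/ℚ)` (`E′ = E/⟨S⟩`, `x(S) = 85`, Z3 case) is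
NON-DEGENERATE — `ctp3iso` 0.2.2 (b2b eng-5, 77c2e2b0…; kit j282405, row seed 605351585407837367, DETCHECK IDENTICAL): `ŝ = 4`, rank `2`,
kernel `2` = the Mordell–Weil image (`mw = 2`), EXACT, self-checks (S_ALT, S_MW, S_RECIP) = (1,1,1) ⇒ the image of `Sel³(E) → S^{(φ̂)}(E′)` is
Mordell–Weil ⇒ `Ш(E)[3] ⊆ Ш(E)[φ] = 0` (van Beek–Fisher 2018; Fisher 2003 Thm. 3); **(B)** full `3`-descent `dim Sel³(E/ℚ) = r + [3 ∣ #E(ℚ)_tors]`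
(cgs25 `desc3borel`, planner JOB #46-P) — both are instrument READS of the same binder; nothing about them is asserted by this file. Other reads:
`hr : r_an = 1` (Cremona ‖ PARI), `hq`/`hv` : `#Ш_an(19740v1) = 1` (Cremona `allbsd` ‖ PARI leg). **IN THE KERNEL:** `classX2_19740v1` (ellipticity, minimality, the sign at `3`, `E[3]` reducible by the rational `Ψ₃`-root `85`) IMPORTED BY
NAME from k5-p3's L3 display `Theorems/EisensteinPrimesB11L3Cert19740v1.lean` (not restated — two PRE-free roads at this pair). **PUBLISHED fact BY NAME:** `hGZK` only.
Refs: [Miller2011LMS] Def. 1.1; [SilvermanAEC2009] VII.1 Rem. 1.1, VII.5 Prop. 5.1, Ex. 3.7, X.4.2; [Kraus1989] Prop. 1–2; van Beek–Fisher, Acta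
Arith. 185 (2018); Fisher, JNT 98 (2003) Thm. 3; Cremona `ecdata` class 19740v.
-/

set_option autoImplicit false
set_option linter.dupNamespace false

noncomputable section

open scoped Classical

open WeierstrassCurve Literature.NumberTheory.EllipticCurves
  Literature.NumberTheory.EllipticCurves.Rank1Residual
  Literature.NumberTheory.EllipticCurves.Rank1Residual.Typed
  Summit.BirchSwinnertonDyer.Rank1Residual
  Summit.BirchSwinnertonDyer.Rank1Residual.X2
  Summit.BirchSwinnertonDyer.BirchSwinnertonDyer.Theorems.B11L3Cert19740v1
  Summit.BirchSwinnertonDyer.BirchSwinnertonDyer.Theorems.B11DescentCertificate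

namespace Summit.BirchSwinnertonDyer.BirchSwinnertonDyer.Theorems.B11Descent19740v1

/-- **X2c INSTANCE, DESCENT ROAD (SECOND LAYER) — `BSD(19740v1, 3)`** from Gross–Zagier–Kolyvagin (`hGZK`) and the two READS on `19740v1`:
`hq`/`hv` (`#Ш_an` a `3`-adic unit) and `h : Ш(19740v1)[3] = 0`, the latter carrying the two method-disjoint certificates (A) first `3`-isogeny
descent + Cassels–Tate NONDEG on `S^{(φ̂)}` (ctp3iso) and (B) full `3`-descent (desc3borel) named in the module docstring; door
`X2.cellC_bsdp_of_shaAn_unit_of_noPTorsion` with `CellC 19740v1 3 = ⟨hr, classX2_19740v1⟩`. Nothing booked; `BSDp` only.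
[cite: Miller2011LMS, §1 and Def. 1.1] -/
theorem bsdp_19740v1_at_three_of_descent (hGZK : rank_eq_analyticRank_of_analyticRank_le_one)
    (W : WeierstrassCurve ℚ) [W.IsElliptic] [W.IsGloballyMinimal] (hW : W = ⟨0, 1, 0, (-5045), 83100⟩)
    (hr : W.analyticRank = 1) {q : ℚ} (hq : shaAn W = (q : ℂ)) (hv : padicValRat 3 q = 0)
    (h : ∀ x : W.sha, (3 : ℤ) • x = 0 → x = 0) : BSDp W 3 := by
  subst hW
  exact X2.cellC_bsdp_of_shaAn_unit_of_noPTorsion _ 3 hGZK ⟨hr, classX2_19740v1⟩ hq hv h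

/-- **The same on the route's cell predicate**: `CellC 19740v1 3 → BSD(19740v1, 3)` modulo GZK and the two reads. [cite: Miller2011LMS, §1 and Def. 1.1] -/
theorem targetC_19740v1_at_three_of_descent (hGZK : rank_eq_analyticRank_of_analyticRank_le_one)
    (W : WeierstrassCurve ℚ) [W.IsElliptic] [W.IsGloballyMinimal] (hW : W = ⟨0, 1, 0, (-5045), 83100⟩)
    {q : ℚ} (hq : shaAn W = (q : ℂ)) (hv : padicValRat 3 q = 0) (h : ∀ x : W.sha, (3 : ℤ) • x = 0 → x = 0) :
    CellC W 3 → BSDp W 3 :=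
  fun hc ↦ bsdp_19740v1_at_three_of_descent hGZK W hW hc.1 hq hv h

/-- **DECISION at the pair**: under the read `Ш(19740v1)[3] = 0`, `BSD(19740v1, 3) ↔ ord₃ #Ш_an = 0` — had ctp3iso read DEGENERATE here
(kernel of the pairing larger than the Mordell–Weil image), `Ш(19740v1)[3] ≠ 0` with a unit `#Ш_an` would have REFUTED `BSD(19740v1, 3)`
(`Theorems/EisensteinPrimesCasselsTateDecision.lean`). [cite: Miller2011LMS, §1 and Def. 1.1] -/
theorem bsdp_19740v1_at_three_iff_of_descent (hGZK : rank_eq_analyticRank_of_analyticRank_le_one)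
    (W : WeierstrassCurve ℚ) [W.IsElliptic] [W.IsGloballyMinimal] (hW : W = ⟨0, 1, 0, (-5045), 83100⟩)
    (hr : W.analyticRank = 1) (h : ∀ x : W.sha, (3 : ℤ) • x = 0 → x = 0) {q : ℚ} (hq : shaAn W = (q : ℂ)) :
    BSDp W 3 ↔ padicValRat 3 q = 0 := by
  subst hW
  exact X2.cellC_bsdp_iff_padicValRat_shaAn_eq_zero_of_noPTorsion _ 3 hGZK ⟨hr, classX2_19740v1⟩ h hq

end Summit.BirchSwinnertonDyer.BirchSwinnertonDyer.Theorems.B11Descent19740v1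

end
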